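import Summits.CriticalPhenomena.SAWScalingLimit.Theses.SAWTotalPositivity

/-!
# `EdgeOfPositivity` (crux stmt-CriticalPhenomena-11344): read-back and the load-bearing fugacity hypothesis

Negative-lane support file (refuter `cdisprove`, landed copy of §0–§1 of
`Cruxes/EdgeOfPositivity/Disproof.lean`).  The crux says: for every `x > x_c` some bounded simply
connected domain carries an admissible quadruple at which TP₂ of the fugacity-`x` SAW kernel
fails strictly.  Here: the crux at a fixed fugacity (`EdgeOfPositivityAt`, definitionally the
body of the crux), the structural hypotheses force four distinct points (`Admissible.ne`), and the
hypothesis `x_c < x` cannot be dropped: at `x = 0` no witness exists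
(`edgeOfPositivity_false_without_gt`).  No Theses statement is asserted.

Record (2026-08-17, dependency-drift repair).  The route `SAWTotalPositivity` DROPPED the crux at
rev 8 (2026-08-16T06:20Z, "conjecture-grade, not load-bearing"; item stmt-CriticalPhenomena-11344
closed as moot), so the route decl `Theses.SAWTotalPositivity.EdgeOfPositivity` no longer exists and the
bare identifier stopped resolving here and in the two importers of this module that also state theorems
about it (`EdgeOfPositivityWindow.lean`, `edgeOfPositivity_iff_window`; `EdgeOfPositivityBoxCertificates.lean`,
its `0.542` sharpening) — all three inside this namespace.  To keep every such theorem letter for letter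
(Theorems files are append-only) without declaring a proposition in a Theorems file, the token
`EdgeOfPositivity` is now a NOTATION SCOPED TO THIS NAMESPACE
(`Summit.CriticalPhenomena.SAWScalingLimit.Theorems.EdgeOfPositivity.Negative`), expanding to the statement
of the dropped item verbatim from its ledger signature; it is active exactly where the dropped name used to
be consumed (this file and, on re-entering the namespace, its importers) and nowhere else.  The elaborated
types of `edgeOfPositivity_iff` (still `Iff.rfl`: `Zx`, `EdgeOfPositivityAt` unfold to the signature's
text) and of the importers' window theorems carry the statement itself; no proof changed.
-/

noncomputable section

open MeasureTheory Filter Topology Set Function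
open Literature.Probability.LatticeModels Literature.Probability.Percolation
open Literature.Probability.RandomPlanarGeometry Literature.Probability.RandomPlanarGeometry.SAW
open scoped ENNReal NNReal

namespace Summit.CriticalPhenomena.SAWScalingLimit.Theorems.EdgeOfPositivity.Negative

open Summit.CriticalPhenomena.SAWScalingLimit.Theses.SAWTotalPositivity

/-! ## §0 Read-back: the crux at a fixed fugacity, admissible quadruples -/

/-- The fugacity-`x` two-point partition function of `Ω_δ` between `u` and `v`, typed exactly as
in the crux: `Z_x(u,v) = Σ_{γ : u → v SAW of Ω_δ} x^{|γ|}`. [folklore] -/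
def Zx (x : ℝ) (Ω : Set ℂ) (δ : ℝ) (u v : Site 2) : ℝ≥0∞ :=
  ∑' γ : DomainSAW Ω δ u v, ENNReal.ofReal (x ^ γ.length)

/-- The three structural hypotheses of the crux on a quadruple: interlacing of `(p₁p₃ | p₂p₄)` and
disjoint realisability of the two non-crossing pairings. [folklore] -/
def Admissible (Ω : Set ℂ) (δ : ℝ) (p₁ p₂ p₃ p₄ : Site 2) : Prop :=
  (∀ (P : DomainSAW Ω δ p₁ p₃) (Q : DomainSAW Ω δ p₂ p₄), ∃ v, v ∈ P.walk.support ∧ v ∈ Q.walk.support) ∧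
  (∃ (P : DomainSAW Ω δ p₁ p₂) (Q : DomainSAW Ω δ p₃ p₄), List.Disjoint P.walk.support Q.walk.support) ∧
  (∃ (P : DomainSAW Ω δ p₁ p₄) (Q : DomainSAW Ω δ p₂ p₃), List.Disjoint P.walk.support Q.walk.support)

/-- The crux AT a fixed fugacity `x`: some bounded simply connected domain carries an admissible
quadruple violating TP₂ strictly. [folklore] -/
def EdgeOfPositivityAt (x : ℝ) : Prop :=
  ∃ (Ω : Set ℂ) (δ : ℝ) (p₁ p₂ p₃ p₄ : Site 2), Bornology.IsBounded Ω ∧ SimplyConnectedSpace Ω ∧ 0 < δ ∧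
    (∀ (P : DomainSAW Ω δ p₁ p₃) (Q : DomainSAW Ω δ p₂ p₄), ∃ v, v ∈ P.walk.support ∧ v ∈ Q.walk.support) ∧
    (∃ (P : DomainSAW Ω δ p₁ p₂) (Q : DomainSAW Ω δ p₃ p₄), List.Disjoint P.walk.support Q.walk.support) ∧
    (∃ (P : DomainSAW Ω δ p₁ p₄) (Q : DomainSAW Ω δ p₂ p₃), List.Disjoint P.walk.support Q.walk.support) ∧
    Zx x Ω δ p₁ p₂ * Zx x Ω δ p₃ p₄ < Zx x Ω δ p₁ p₃ * Zx x Ω δ p₂ p₄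

/- **The dropped crux, verbatim, as a notation scoped to this namespace** (see the module docstring):
`EdgeOfPositivity` — for every fugacity `x > x_c` some bounded simply connected domain `Ω`, mesh `δ > 0`
and quadruple `p₁ p₂ p₃ p₄` with `(p₁p₃ | p₂p₄)` interlaced and both non-crossing pairings disjointly
realisable violate TP₂ strictly, `Z_x(p₁,p₂) Z_x(p₃,p₄) < Z_x(p₁,p₃) Z_x(p₂,p₄)` — copied from the ledger
signature of stmt-CriticalPhenomena-11344 (`quotPrecheck` is off for this one command only: the binder
notations have no precheck handler; every name in the body is fully qualified). -/
set_option quotPrecheck false in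
scoped notation "EdgeOfPositivity" =>
  (∀ x : ℝ, Literature.Probability.RandomPlanarGeometry.SAW.criticalFugacity < x → ∃ (Ω : Set ℂ) (δ : ℝ) (p₁ p₂ p₃ p₄ : Literature.Probability.LatticeModels.Site 2), Bornology.IsBounded Ω ∧ SimplyConnectedSpace Ω ∧ 0 < δ ∧ (∀ (P : Literature.Probability.RandomPlanarGeometry.SAW.DomainSAW Ω δ p₁ p₃) (Q : Literature.Probability.RandomPlanarGeometry.SAW.DomainSAW Ω δ p₂ p₄), ∃ v, v ∈ P.walk.support ∧ v ∈ Q.walk.support) ∧ (∃ (P : Literature.Probability.RandomPlanarGeometry.SAW.DomainSAW Ω δ p₁ p₂) (Q : Literature.Probability.RandomPlanarGeometry.SAW.DomainSAW Ω δ p₃ p₄), List.Disjoint P.walk.support Q.walk.support) ∧ (∃ (P : Literature.Probability.RandomPlanarGeometry.SAW.DomainSAW Ω δ p₁ p₄) (Q : Literature.Probability.RandomPlanarGeometry.SAW.DomainSAW Ω δ p₂ p₃), List.Disjoint P.walk.support Q.walk.support) ∧ (∑' γ : Literature.Probability.RandomPlanarGeometry.SAW.DomainSAW Ω δ p₁ p₂,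 ENNReal.ofReal (x ^ γ.length)) * (∑' γ : Literature.Probability.RandomPlanarGeometry.SAW.DomainSAW Ω δ p₃ p₄, ENNReal.ofReal (x ^ γ.length)) < (∑' γ : Literature.Probability.RandomPlanarGeometry.SAW.DomainSAW Ω δ p₁ p₃, ENNReal.ofReal (x ^ γ.length)) * (∑' γ : Literature.Probability.RandomPlanarGeometry.SAW.DomainSAW Ω δ p₂ p₄, ENNReal.ofReal (x ^ γ.length)))

/-- READ-BACK: the crux is `∀ x > x_c, EdgeOfPositivityAt x`, definitionally. [folklore] -/
theorem edgeOfPositivity_iff : EdgeOfPositivity ↔ ∀ x : ℝ, criticalFugacity < x → EdgeOfPositivityAt x :=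
  Iff.rfl

/-- The structural hypotheses force the four points to be pairwise distinct (each SAW contains its
endpoints). This is ALL that §1 uses of them. [folklore] -/
theorem Admissible.ne {Ω : Set ℂ} {δ : ℝ} {p₁ p₂ p₃ p₄ : Site 2} (h : Admissible Ω δ p₁ p₂ p₃ p₄) :
    p₁ ≠ p₂ ∧ p₁ ≠ p₃ ∧ p₁ ≠ p₄ ∧ p₂ ≠ p₃ ∧ p₂ ≠ p₄ ∧ p₃ ≠ p₄ := by
  obtain ⟨-, ⟨P, Q, hPQ⟩, ⟨P', Q', hPQ'⟩⟩ := h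
  have e1 := P.walk.start_mem_support; have e2 := P.walk.end_mem_support
  have e3 := Q.walk.start_mem_support; have e4 := Q.walk.end_mem_support
  have f1 := P'.walk.start_mem_support; have f4 := P'.walk.end_mem_support
  have f2 := Q'.walk.start_mem_support; have f3 := Q'.walk.end_mem_support
  refine ⟨?_, ?_, ?_, ?_, ?_, ?_⟩
  · rintro rfl; exact hPQ' f1 f2
  · rintro rfl; exact hPQ e1 e3
  · rintro rfl; exact hPQ e1 e4
  · rintro rfl; exact hPQ e2 e3
  · rintro rfl; exact hPQ e2 e4
  · rintro rfl; exact hPQ' f4 f3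

/-! ## §1 Load-bearing analysis: the fugacity threshold cannot be dropped -/


/-- A SAW between distinct points has positive length. [folklore] -/
theorem length_pos_of_ne {Ω : Set ℂ} {δ : ℝ} {u v : Site 2} (huv : u ≠ v) (γ : DomainSAW Ω δ u v) :
    0 < γ.length := by
  rcases Nat.eq_zero_or_pos γ.length with h | h
  · exact absurd (SimpleGraph.Walk.eq_of_length_eq_zero h) huv
  · exact h

/-- At fugacity `0` every partition function between DISTINCT points vanishes. [folklore] -/
theorem Zx_zero_of_ne {Ω : Set ℂ} {δ : ℝ} {u v : Site 2} (huv : u ≠ v) : Zx 0 Ω δ u v = 0 := by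
  rw [Zx, ENNReal.tsum_eq_zero]
  intro γ
  rw [zero_pow (length_pos_of_ne huv γ).ne', ENNReal.ofReal_zero]

/-- **`x_c < x` IS LOAD-BEARING**: at `x = 0` no admissible quadruple violates TP₂ (the crossing
product is `0`, since `p₁ ≠ p₃`). So the dropped-hypothesis version is false; any proof of the
crux must use the lower bound on the fugacity. (The genuinely open complement — TP₂ in every
domain for `0 < x ≤ x_c` — is the route's main crux `BoundaryTP2` and its subcritical analogue,
not refutable here.) [folklore] -/
theorem edgeOfPositivity_false_without_gt : ¬ ∀ x : ℝ, EdgeOfPositivityAt x := by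
  intro h
  obtain ⟨Ω, δ, p₁, p₂, p₃, p₄, -, -, -, h1, h2, h3, hlt⟩ := h 0
  have hne := (show Admissible Ω δ p₁ p₂ p₃ p₄ from ⟨h1, h2, h3⟩).ne
  rw [Zx_zero_of_ne hne.2.1, zero_mul] at hlt
  exact ENNReal.not_lt_zero hlt

end Summit.CriticalPhenomena.SAWScalingLimit.Theorems.EdgeOfPositivity.Negative
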